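import Literature.RingTheory.MvPolynomial.Directrix
import Mathlib.Algebra.MvPolynomial.Rename
import HarnessLib

/-!
# The directrix of a polynomial extension: `e(A[X]) = e(A) + 1` (CJS Rem. 2.9 (c))

Topic: `Literature/RingTheory/MvPolynomial`. CJS, LNM 2270, Rem. 2.9 (c): "If `X` is a variable,
then obviously `ν*(A[X]) = ν*(A)` … On the other hand, `Dir_K(A[X]) ≅ Dir_K(A) ×_K 𝔸¹_K`, i.e.,
`e_K(A[X]) = e_K(A) + 1`." For `A = S/I`, `S = k[X_1, …, X_n]`, the graded algebra `A[X]` is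
`S'/I S'` with `S' = k[X_1, …, X_{n+1}]`; we PROVE `e(S'/I S') = e(S/I) + 1`
(`directrixDim_map_rename_castSucc`, `S ↪ S'` being `rename Fin.castSucc`), through

* **`Directs.map_algHom`** — directing subspaces are transported by ANY `k`-algebra homomorphism
  `θ : S → S''` mapping linear forms to linear forms: if `T` directs `I` then `θ(T)` directs
  `θ(I) · S''` (generalising `Directs.map_algEquiv`);
* `finrank_directrixSpace_map_rename_castSucc` — **`dim_k 𝒯(I S') = dim_k 𝒯(I)`**: `≤` by transport
  along `S ↪ S'`, `≥` by transport along the retraction `S' ↠ S`, `X_{n+1} ↦ 0` (which recovers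
  `I` from `I S'`), and `dim θ(T) ≤ dim T`.

## References

* V. Cossart, U. Jannsen, S. Saito, *Desingularization: Invariants and Strategy*, LNM 2270
  (2020), Ch. 2, Rem. 2.9 (c). [CossartJannsenSaito2020]
-/

noncomputable section

open MvPolynomial Module

namespace Literature.RingTheory.MvPolynomial

variable {K : Type*} [Field K] {n n' : ℕ}

/-! ## Transport along algebra homomorphisms -/

/-- **Directing subspaces are transported by algebra homomorphisms preserving linear forms**: if
`T` directs `I` and `θ(S_1) ⊆ S''_1` then `θ(T)` directs `θ(I) · S''`
(`θ(k[T]) = k[θ T]`, `θ(I ∩ k[T]) ⊆ θ(I) S'' ∩ k[θ T]`). [cite: CossartJannsenSaito2020, Lemma 2.7] -/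
theorem Directs.map_algHom {I : Ideal (MvPolynomial (Fin n) K)} {T : Submodule K (MvPolynomial (Fin n) K)}
    (θ : MvPolynomial (Fin n) K →ₐ[K] MvPolynomial (Fin n') K)
    (hθ : ∀ f : MvPolynomial (Fin n) K, f.IsHomogeneous 1 → (θ f).IsHomogeneous 1)
    (h : Directs I T) :
    Directs (I.map (θ : MvPolynomial (Fin n) K →+* MvPolynomial (Fin n') K)) (T.map θ.toLinearMap) := by
  refine ⟨?_, ?_⟩
  · rintro _ ⟨f, hf, rfl⟩
    exact hθ f (h.1 hf)
  · refine (Ideal.map_mono h.2).trans ?_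
    rw [Ideal.map_span]
    refine Ideal.span_mono ?_
    rintro _ ⟨g, ⟨hgI, hgT⟩, rfl⟩
    refine ⟨Ideal.mem_map_of_mem _ hgI, ?_⟩
    have hadj : ((Algebra.adjoin K (T : Set (MvPolynomial (Fin n) K))).map θ :
        Set (MvPolynomial (Fin n') K)) =
        Algebra.adjoin K ((T.map θ.toLinearMap : Submodule K (MvPolynomial (Fin n') K)) :
          Set (MvPolynomial (Fin n') K)) := by
      rw [AlgHom.map_adjoin, Submodule.map_coe]
      rfl
    rw [SetLike.mem_coe, ← SetLike.mem_coe, ← hadj]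
    exact ⟨g, hgT, rfl⟩

/-- Consequently `𝒯(θ(I) S'') ⊆ θ(𝒯(I))` and **`dim 𝒯(θ(I) S'') ≤ dim 𝒯(I)`**. [cite: CossartJannsenSaito2020, Lemma 2.7] -/
theorem finrank_directrixSpace_map_algHom_le (I : Ideal (MvPolynomial (Fin n) K))
    (θ : MvPolynomial (Fin n) K →ₐ[K] MvPolynomial (Fin n') K)
    (hθ : ∀ f : MvPolynomial (Fin n) K, f.IsHomogeneous 1 → (θ f).IsHomogeneous 1) :
    Module.finrank K (directrixSpace (I.map (θ : MvPolynomial (Fin n) K →+* MvPolynomial (Fin n') K))) ≤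
      Module.finrank K (directrixSpace I) := by
  haveI : FiniteDimensional K (directrixSpace I) :=
    Submodule.finiteDimensional_of_le (directrixSpace_le_one I)
  have hd := (directs_directrixSpace I).map_algHom θ hθ
  haveI : FiniteDimensional K ((directrixSpace I).map θ.toLinearMap) := Module.Finite.map _ _
  exact (Submodule.finrank_mono (directrixSpace_le hd)).trans (Submodule.finrank_map_le _ _)

/-! ## Adding a variable -/

/-- `(X_{n+1} ↦ 0) ∘ (S ↪ S') = id`. [folklore] -/
theorem aeval_lastCases_comp_rename : (aeval (Fin.lastCases (motive := fun _ => MvPolynomial (Fin n) K) 0 X) : MvPolynomial (Fin (n + 1)) K →ₐ[K] MvPolynomial (Fin n) K).comp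
      (rename Fin.castSucc : MvPolynomial (Fin n) K →ₐ[K] MvPolynomial (Fin (n + 1)) K) = AlgHom.id K _ := by
  refine MvPolynomial.algHom_ext fun i => ?_
  rw [AlgHom.comp_apply, AlgHom.id_apply, rename_X, aeval_X, Fin.lastCases_castSucc]

-- The inclusion `rename Fin.castSucc : S →ₐ[K] S'` preserves linear forms by Mathlib's
-- `MvPolynomial.IsHomogeneous.rename_isHomogeneous` (dot notation `hf.rename_isHomogeneous`, used
-- below); the former restatement `isHomogeneous_one_rename_castSucc` was removed (dedup-00629).

/-- The retraction maps linear forms to linear forms. [folklore] -/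
theorem isHomogeneous_one_aeval_lastCases {f : MvPolynomial (Fin (n + 1)) K} (hf : f.IsHomogeneous 1) :
    (aeval (Fin.lastCases (motive := fun _ => MvPolynomial (Fin n) K) 0 X) f).IsHomogeneous 1 := by
  have h1 : ∀ i : Fin (n + 1),
      ((Fin.lastCases (motive := fun _ => MvPolynomial (Fin n) K) 0 X) i).IsHomogeneous 1 := by
    intro i
    refine Fin.lastCases ?_ (fun j => ?_) i
    · rw [Fin.lastCases_last]
      exact isHomogeneous_zero (Fin n) K 1
    · rw [Fin.lastCases_castSucc]
      exact isHomogeneous_X K j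
  exact hf.aeval _ h1

/-- The extended ideal comes back: `(I · S') ↦ I` under `X_{n+1} ↦ 0`. [folklore] -/
theorem map_aeval_lastCases_map_rename (I : Ideal (MvPolynomial (Fin n) K)) :
    (I.map ((rename Fin.castSucc : MvPolynomial (Fin n) K →ₐ[K] MvPolynomial (Fin (n + 1)) K) :
      MvPolynomial (Fin n) K →+* MvPolynomial (Fin (n + 1)) K)).map
      ((aeval (Fin.lastCases (motive := fun _ => MvPolynomial (Fin n) K) 0 X) : MvPolynomial (Fin (n + 1)) K →ₐ[K] MvPolynomial (Fin n) K) :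
      MvPolynomial (Fin (n + 1)) K →+* MvPolynomial (Fin n) K) = I := by
  rw [Ideal.map_map]
  have h : ((aeval (Fin.lastCases (motive := fun _ => MvPolynomial (Fin n) K) 0 X) : MvPolynomial (Fin (n + 1)) K →ₐ[K] MvPolynomial (Fin n) K) :
      MvPolynomial (Fin (n + 1)) K →+* MvPolynomial (Fin n) K).comp
      ((rename Fin.castSucc : MvPolynomial (Fin n) K →ₐ[K] MvPolynomial (Fin (n + 1)) K) :
      MvPolynomial (Fin n) K →+* MvPolynomial (Fin (n + 1)) K) = RingHom.id _ := by
    have := congrArg (fun φ : MvPolynomial (Fin n) K →ₐ[K] MvPolynomial (Fin n) K =>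
      (φ : MvPolynomial (Fin n) K →+* MvPolynomial (Fin n) K)) (aeval_lastCases_comp_rename (K := K) (n := n))
    exact this
  rw [h, Ideal.map_id]

/-- **`dim_k 𝒯(I · S') = dim_k 𝒯(I)`** for `S' = S[X_{n+1}]`. [cite: CossartJannsenSaito2020, Rem. 2.9 (c)] -/
theorem finrank_directrixSpace_map_rename_castSucc (I : Ideal (MvPolynomial (Fin n) K)) :
    Module.finrank K (directrixSpace (I.map ((rename Fin.castSucc : MvPolynomial (Fin n) K →ₐ[K] MvPolynomial (Fin (n + 1)) K) :
      MvPolynomial (Fin n) K →+* MvPolynomial (Fin (n + 1)) K))) =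
      Module.finrank K (directrixSpace I) := by
  refine le_antisymm (finrank_directrixSpace_map_algHom_le I (rename Fin.castSucc : MvPolynomial (Fin n) K →ₐ[K] MvPolynomial (Fin (n + 1)) K)
    fun f hf => hf.rename_isHomogeneous) ?_
  have h := finrank_directrixSpace_map_algHom_le
    (I.map ((rename Fin.castSucc : MvPolynomial (Fin n) K →ₐ[K] MvPolynomial (Fin (n + 1)) K) :
      MvPolynomial (Fin n) K →+* MvPolynomial (Fin (n + 1)) K))
    (aeval (Fin.lastCases (motive := fun _ => MvPolynomial (Fin n) K) 0 X) :
      MvPolynomial (Fin (n + 1)) K →ₐ[K] MvPolynomial (Fin n) K)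
    fun f hf => isHomogeneous_one_aeval_lastCases hf
  rwa [map_aeval_lastCases_map_rename] at h

/-- **CJS Rem. 2.9 (c): `e(A[X]) = e(A) + 1`**, i.e. `e(S'/I S') = e(S/I) + 1` for
`S' = k[X_1, …, X_{n+1}] = S[X_{n+1}]`. [cite: CossartJannsenSaito2020, Rem. 2.9 (c)] -/
theorem directrixDim_map_rename_castSucc (I : Ideal (MvPolynomial (Fin n) K)) :
    directrixDim (I.map ((rename Fin.castSucc : MvPolynomial (Fin n) K →ₐ[K] MvPolynomial (Fin (n + 1)) K) :
      MvPolynomial (Fin n) K →+* MvPolynomial (Fin (n + 1)) K)) =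
      directrixDim I + 1 := by
  unfold directrixDim
  rw [finrank_directrixSpace_map_rename_castSucc]
  have := finrank_directrixSpace_le I
  omega

end Literature.RingTheory.MvPolynomial

end
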